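/-
Copyright (c) 2026 the pub-hodgecm-mathlib formalisation cell (harness21).  Prover seat hodgecm-mathlib-K2E2-p12 (g10), Track B «K2-LIT», h413 = `stmt-HodgeConjecture-24833`,
route `HCCMUnconditional`; R90-TF section S8 «ContSpec-n½», deal S8-R281 (S8 dealer R90-CS-plan (g4)): (R)′τ OF RECORD, FOURTH EDITION — ★ ED. 3 with its two AXIS letters paid
by ★ p865213 (`hreal` letter-free off the columns' independence; `hPreal` ↦ `hOFFBD`), plus (R)′ under the τ-density letters (★ p865244).
-/
import Summits.HodgeConjecture.HodgeConjecture.Theorems.R90S8ResGMidBlockLeResidualOfRecordV3U3          -- ★ p865313 (this seat) ED. 3 head; brings ★ FILE A, ★ p865131, ★ p864934, ★ p865108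
import Summits.HodgeConjecture.HodgeConjecture.Theorems.R90S8ResGMidTauAxisLettersOfPortsU3              -- ★ p865213 (K2E3-p29): `hPreal_row_of_offAxisBound`, `isClosed_of_codiscrete`, `differentiableOn_compl_of_analyticAt_off`; brings ★ p864973's road
import Summits.HodgeConjecture.HodgeConjecture.Theorems.R90S8ResGMidAtomLocallyBoundedDataOfTauLevelU3   -- ★ p865244: `hW1_of_tauDensity`
import HarnessLib

/-!
# S8 sub-socket (R)′ — `R90S8ResGMidBlockLeResidualOfRecordV4U3`: (R)′τ OF RECORD, FOURTH EDITION — THE AXIS LETTERS PAID (★ p865213); (R)′ UNDER THE ISOTYPIC OR THE τ-DENSITY LETTERS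

Track B ∕ R90-TF, crux h413 = `stmt-HodgeConjecture-24833`, route `HCCMUnconditional`; cell `hodgecm-mathlib`, S8 «ContSpec-n½», sub-socket (R) `sock_S8_res_midBlock_le_residual` ((R)′, B ED. 7
:337).  THEOREMS ONLY (no `def`∕`instance`∕`notation`, no named-fact hypothesis, no `sorry`, default heartbeats); lane `--supports … --as helper`; CLOSES NO SOCKET — composition.

WHAT CHANGES FROM ED. 3 (★ p865313).  The two per-generator AXIS letters leave the binder list: `hreal` (axis reality of the closed-formula `wc`, ED. 3's bytes: no independence clause,
normal-form clause present) is §1 `hreal_row_of_ports'` — ★ p865213's `hreal_row_of_ports` proof, which never used independence nor `Pv ⊆ {Re ≤ 2}`, re-run at ED. 3's bytes (J-S8-RE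
road (3): ★ `im_wc_eq_zero_of_exports_free` on ★ `hTEXP6_row_of_ports` with ★ `hCO_of_transposeRealisations`, (L2) ★ `exists_scalars_of_coords_global`, ★
`exists_eventually_norm_kernelDiag_le_of_coords`, ★ `eventually_im_eq_zero_of_real_offPoles`); `hPreal` (off-axis analyticity, ED. 3's normal-form bytes) is ★ p865213 §3
`hPreal_row_of_offAxisBound` of the weaker letter `hOFFBD` (off-axis BOUNDEDNESS; K2E3-p29's FILE 2 `…TauOffAxisBoundOfGramU3` pays it from the Gram positivity).  §3 offers (R)′ under the
τ-DENSITY letters (★ p865244 `hW1_of_tauDensity`) next to ★ ED. 3's isotypic form.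
* §1 **`hreal_row_of_ports'`**; §2 HEAD **`resGMidBlockτ_le_residual_of_record_v4`** (one term over ★ ED. 3); §3 **`resGMidBlock_le_residual_of_tauDensity_of_tau (hFIN) (hDENSτ) (hτ)`**.
NET LETTER LIST: ONCE {`hDISC` (L1), the F5 block ((V) (iii) bytes), the frames, `hμu`, `hquad`}; PER τ-ADMISSIBLE SECTION {`hunfK` (W1), `hOFFBD` (K2E3-p29 FILE 2)}; PER τ-GENERATOR {`hUNF`
(W1)}; for (R)′ additionally {`hFIN`, `hISO`} or {`hFIN`, `hDENSτ`}.
HONEST LABEL: HC_CM is proved only modulo the 7 printed citations (2 remaining named inputs: hLiu418 = `stmt-HodgeConjecture-24832`, h413 = `stmt-HodgeConjecture-24833`) until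
rung 0 closes; REL ≠ ★ ≠ BUILT; this file asserts no named fact, is conditional by construction on the letters it names, and closes no socket; count-neutral.

## References
* [MoeglinWaldspurger1995] C. Mœglin, J.-L. Waldspurger, *Spectral Decomposition and Eisenstein Series* (1995), I.2.17–I.2.18, IV.1.9–IV.1.11, IV.2.3, V.3.13.
* [Langlands1976] R. P. Langlands, *On the Functional Equations Satisfied by Eisenstein Series*, LNM 544 (1976), §6–§7.
* [Rogawski1990] J. D. Rogawski, *Automorphic Representations of Unitary Groups in Three Variables* (1990), §13.9 p. 229 (ii).
* [BernsteinLapid2019] J. Bernstein, E. Lapid, *On the meromorphic continuation of Eisenstein series*, J. AMS 37 (2024), Thm 2.3, §4, §7.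
-/

set_option autoImplicit false
set_option linter.dupNamespace false  -- the mandated namespace `…HodgeConjecture.HodgeConjecture.R90.S8` (LEAD #1 L1) repeats the summit's segment

noncomputable section

open MeasureTheory Measure NumberField IsDedekindDomain Set Filter Topology ContRepresentation Complex
open scoped ENNReal NNReal ComplexConjugate InnerProductSpace Topology
open Literature.NumberTheory Literature.NumberTheory.Automorphic Literature.NumberTheory.Automorphic.UnitaryGroup Literature.NumberTheory.GaloisRepresentations AdelicGroupData
open Literature.NumberTheory.Automorphic.Arthur2013.Leaves.TECR Literature.NumberTheory.Rogawski1990 Literature.NumberTheory.LFunctions Literature.MeasureTheory.Group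
open Literature.RepresentationTheory.CompactGroups
open Summit.HodgeConjecture.HodgeConjecture.Cruxes.H413.K2E1BorelEisensteinU Summit.HodgeConjecture.HodgeConjecture.Cruxes.H413.K2E1CharacterEisensteinU2Defs
open Summit.HodgeConjecture.HodgeConjecture.Cruxes.H413.K2E1CharacterEisensteinU3PairDefs Summit.HodgeConjecture.HodgeConjecture.Cruxes.H413.K2E1ChiSectionSpaceU3PairDefs
open Summit.HodgeConjecture.HodgeConjecture.Cruxes.H413.K2E1BLBorelSpacesU2Defs Summit.HodgeConjecture.HodgeConjecture.Cruxes.H413.K2E1BLBorelOperatorsU2Defs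
open Summit.HodgeConjecture.HodgeConjecture.Cruxes.H413.K2E1CuspidalSpectrumUnitary (residualSubspace)
open Summit.HodgeConjecture.HodgeConjecture.Cruxes.H413.R90S8ResGMidBlockScatteringOfRecordU3 (integrable_restrict_mul_conj_of_bounded)
open Summit.HodgeConjecture.HodgeConjecture.Cruxes.H413.K2E1ChiAxisRealityOfRecordCMThree (im_wc_eq_zero_of_exports_free)
open Summit.HodgeConjecture.HodgeConjecture.Cruxes.H413.K2E1ChiMaassSelbergOnAxisScalarsOfRecordCMThree (exists_scalars_of_coords_global exists_eventually_norm_kernelDiag_le_of_coords eventually_im_eq_zero_of_real_offPoles)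

namespace Summit.HodgeConjecture.HodgeConjecture.R90.S8

variable (L : Type) [Field L] [NumberField L] [IsCMField L] [MeasurableSpace (quasiSplit (↥(maximalRealSubfield L)) L (IsCMField.complexConj L) 3).Adelic] [BorelSpace (quasiSplit (↥(maximalRealSubfield L)) L (IsCMField.complexConj L) 3).Adelic]

/-! ## §1 The axis-reality row at ED. 3's bytes (★ p865213's road) -/

/-- **★ p865213's `hreal_row_of_ports` WITH ITS THREE IDLE HYPOTHESES OFF THE COLUMN DATA AND THE NORMAL-FORM CLAUSE ON** (ED. 3's `hreal` binder, byte for byte): K2E3-p29's proof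
uses neither the columns' linear independence nor `Pv ⊆ {Re ≤ 2}` — its road is J-S8-RE (3) ★ `im_wc_eq_zero_of_exports_free` on the exports-with-(E6) of ports ★ `hTEXP6_row_of_ports`
(co-weight line ★ `hCO_of_transposeRealisations`), (L2) ★ `exists_scalars_of_coords_global`, ★ `exists_eventually_norm_kernelDiag_le_of_coords`, ★ `eventually_im_eq_zero_of_real_offPoles` —
so the same term pays the per-generator AXIS-REALITY letter for the CONCATENATED (not independent) columns of ED. 3. [cite: MoeglinWaldspurger1995, IV.1.10–IV.1.11, IV.2.3]
[cite: Langlands1976, §7] [cite: BernsteinLapid2019, Thm 2.3, §4] -/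
theorem hreal_row_of_ports' [MeasurableSpace (AdeleRing (𝓞 L) L)ˣ] [BorelSpace (AdeleRing (𝓞 L) L)ˣ]
    [MeasurableSpace ↥(arch (↥(maximalRealSubfield L)) L (IsCMField.complexConj L) 3 ((StdForm.antidiagonal 3).over L))] [BorelSpace ↥(arch (↥(maximalRealSubfield L)) L (IsCMField.complexConj L) 3 ((StdForm.antidiagonal 3).over L))] [MeasurableSpace ↥(finAdelic (↥(maximalRealSubfield L)) L (IsCMField.complexConj L) 3 ((StdForm.antidiagonal 3).over L))] [BorelSpace ↥(finAdelic (↥(maximalRealSubfield L)) L (IsCMField.complexConj L) 3 ((StdForm.antidiagonal 3).over L))]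
    (μ : Measure (quasiSplit (↥(maximalRealSubfield L)) L (IsCMField.complexConj L) 3).automorphicQuotient) [(quasiSplit (↥(maximalRealSubfield L)) L (IsCMField.complexConj L) 3).IsAutomorphicMeasure μ]
    (νG : Measure (quasiSplit (↥(maximalRealSubfield L)) L (IsCMField.complexConj L) 3).Adelic) [νG.IsHaarMeasure] [νG.IsInvInvariant] [SFinite νG]
    {β : (quasiSplit (↥(maximalRealSubfield L)) L (IsCMField.complexConj L) 3).Adelic → ℝ≥0∞}
    (hβ : IsCoveringWeight ↥((arithmeticBorel (↥(maximalRealSubfield L)) L (IsCMField.complexConj L) 3).map (quasiSplit (↥(maximalRealSubfield L)) L (IsCMField.complexConj L) 3).arithmeticSubgroup.subtype) β)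
    {μZ : Measure (borelQuotient (↥(maximalRealSubfield L)) L (IsCMField.complexConj L) 3)} [SFinite μZ]
    (hμZ : ∀ f : borelQuotient (↥(maximalRealSubfield L)) L (IsCMField.complexConj L) 3 → ℝ≥0∞, Measurable f → ∫⁻ z, f z ∂μZ = ∫⁻ g, β g * f (toBorelQuotient (↥(maximalRealSubfield L)) L (IsCMField.complexConj L) 3 g) ∂νG)
    (μa : Measure ↥(arch (↥(maximalRealSubfield L)) L (IsCMField.complexConj L) 3 ((StdForm.antidiagonal 3).over L))) [μa.IsHaarMeasure] [μa.IsMulRightInvariant]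
    (μf : Measure ↥(finAdelic (↥(maximalRealSubfield L)) L (IsCMField.complexConj L) 3 ((StdForm.antidiagonal 3).over L))) [μf.IsHaarMeasure]
    (ξ : OneDimAutRepH L) (μω : HeckeCharacter L) (hμu : μω.IsUnitary)
    (hquad : ∀ x : ideleGroup ↥(maximalRealSubfield L), μω (AdeleRing.ideleBaseChange (↥(maximalRealSubfield L)) L x) = quadraticHeckeCharCM L x) :
      ∀ (U₀ : Subgroup ↥(finAdelic (↥(maximalRealSubfield L)) L (IsCMField.complexConj L) 3 ((StdForm.antidiagonal 3).over L))) (_ : IsTauLevel L U₀)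
      (φ : (quasiSplit (↥(maximalRealSubfield L)) L (IsCMField.complexConj L) 3).Adelic → ℂ) (_ : φ ∈ chiSectionSpacePair (ξ.bcη⁻¹ * ξ.bcψ⁻¹ * μω) ξ.ψ (tauLevel L U₀) ((1 : ↥(tauLevel L U₀) →* ℂ) : ↥(tauLevel L U₀) → ℂ)) (_ : Continuous φ)
      (_ : IsArchFinite L φ)
      (ν : Measure ↥(adelicUnipotent (↥(maximalRealSubfield L)) L (IsCMField.complexConj L) 3)) (_ : ν.IsHaarMeasure) (𝓕 : Set ↥(adelicUnipotent (↥(maximalRealSubfield L)) L (IsCMField.complexConj L) 3)) (_ : IsFundamentalDomain ↥(rationalUnipotent (↥(maximalRealSubfield L)) L (IsCMField.complexConj L) 3) 𝓕 ν) (_ : IsCompact (closure 𝓕)) (_ : ν.IsInvInvariant) (_ : ν 𝓕 = 1),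
      ∀ (ι : Type) [Fintype ι] (φ' : ι → (quasiSplit (↥(maximalRealSubfield L)) L (IsCMField.complexConj L) 3).Adelic → ℂ) (qv qcv : ι → ℂ → ℂ) (Pv : Set ℂ),
        (∀ j, IsChiSectionPair (reflectChar (IsCMField.complexConj L) (ξ.bcη⁻¹ * ξ.bcψ⁻¹ * μω)) ξ.ψ (φ' j)) →
        (∀ j, Continuous (φ' j)) →
        (∀ j, ∃ C : ℝ, ∀ x, ‖φ' j x‖ ≤ C) →
        (∀ z : ℂ, 2 < z.re → (∑ j, qv j z • φ' j) = ((((ν 𝓕).toReal⁻¹ : ℝ)) : ℂ) • (fun g : (quasiSplit (↥(maximalRealSubfield L)) L (IsCMField.complexConj L) 3).Adelic => (∫ v : ↥(adelicUnipotent (↥(maximalRealSubfield L)) L (IsCMField.complexConj L) 3), flatSectionU φ z ((quasiSplit (↥(maximalRealSubfield L)) L (IsCMField.complexConj L) 3).toAdelic (weylLongU ((IsCMField.complexConj L : L ≃ₐ[↥(maximalRealSubfield L)] L) : L →+* L) (rfl : (StdForm.antidiagonal 3).over L = (StdForm.antidiagonal 3).over L)) * ((v : (quasiSplit (↥(maximalRealSubfield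 L)) L (IsCMField.complexConj L) 3).Adelic) * g)) ∂ν) * (((borelHeight g : ℝ) : ℂ) ^ (z - 2)))) →
        (∀ z₀ : ℂ, ∀ᶠ s in 𝓝[≠] z₀, s ∉ Pv) →
        (∀ z ∈ Pv, z.re ≤ 2) →
        (∀ j (z : ℂ), z ∉ Pv → AnalyticAt ℂ (qcv j) z) →
        (∀ j (z : ℂ), 2 < z.re → qcv j z = qv j z) →
        (∀ j, MeromorphicNFOn (qcv j) univ) →
      (∀ (μK : Measure ↥((standardMaximalCompactGL 3 L).comap (adelicVal (↥(maximalRealSubfield L)) L (IsCMField.complexConj L) 3 ((StdForm.antidiagonal 3).over L)) : Subgroup (quasiSplit (↥(maximalRealSubfield L)) L (IsCMField.complexConj L) 3).Adelic)) (_ : μK.IsHaarMeasure) (νI : Measure (AdeleRing (𝓞 L) L)ˣ) (_ : νI.IsHaarMeasure) (𝓕I : Set (AdeleRing (𝓞 L) L)ˣ) (_ : IsIdeleClassDomain L 𝓕I) (wc : ℂ → ℂ),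
          (∀ z : ℂ, wc z = (∑ j, qcv j z * ∫ k, φ' j (k : (quasiSplit (↥(maximalRealSubfield L)) L (IsCMField.complexConj L) 3).Adelic) * conj (φ (k : (quasiSplit (↥(maximalRealSubfield L)) L (IsCMField.complexConj L) 3).Adelic)) ∂μK) * ∫ x in {x : (AdeleRing (𝓞 L) L)ˣ | (IdeleClassGroup.ideleNorm L x : ℝ) ≤ 1} ∩ 𝓕I, ((IdeleClassGroup.ideleNorm L x : ℝ) : ℂ) * (((reflectChar (IsCMField.complexConj L) (ξ.bcη⁻¹ * ξ.bcψ⁻¹ * μω) x : ℂˣ) : ℂ) * conj (((ξ.bcη⁻¹ * ξ.bcψ⁻¹ * μω) x : ℂˣ) : ℂ)) ∂νI) → ∀ᶠ x : ℝ in 𝓝[≠] (3 / 2 : ℝ), (wc (x : ℂ)).im = 0) := by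
  have hTEXP6 := hTEXP6_row_of_ports L μ νG hβ hμZ μa μf ξ μω hμu (hCO_of_transposeRealisations L ξ μω hμu)
  intro U₀ hU₀ φ hφV hφc hφa ν hν 𝓕 h𝓕N h𝓕c hνi hν1 ι _ φ' qv qcv Pv _hb hφ'c hφ'bd hqφ hPvcd _hPvre hqcvP hqcvq _hNF μK hμK νI hνI 𝓕I h𝓕I wc hwc
  -- the block character: unitary, trivial on the positive real ideles; `ξ.ψ` unitary and automorphic; `φ` a bounded pair-section
  have hχ₁u : ((ξ.bcη⁻¹ * ξ.bcψ⁻¹ * μω)).IsUnitary := isUnitary_blockChar L ξ μω hμu (norm_eta_apply_eq_one L ξ) (norm_psi_apply_eq_one L ξ)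
  have hρ₁ : ∀ r : ℝ≥0ˣ, ((ξ.bcη⁻¹ * ξ.bcψ⁻¹ * μω)) (posRealIdele L r) = 1 := midBlockChar_posRealIdele L ξ μω hquad
  have hφ : IsChiSectionPair (ξ.bcη⁻¹ * ξ.bcψ⁻¹ * μω) ξ.ψ φ := isChiSectionPair_of_mem hφV
  obtain ⟨Cφ, hφC⟩ := exists_norm_le_of_isChiSectionPair L hχ₁u (norm_psi_apply_eq_one L ξ) hφ hφc
  choose Cb hCb using hφ'bd
  -- (E6) at `T = 1` from the exports-with-(E6) τ-row
  obtain ⟨Ec, P₆, hP₆c, hP₆cd, -, hE2, -, -, -, hE6⟩ := hTEXP6 U₀ hU₀ φ hφV hφc hφa ν hν 𝓕 h𝓕N h𝓕c hνi hν1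
  obtain ⟨Fam, hFd, hFam⟩ := hE6 1 le_rfl
  -- (L2) the continued scalars read off the column data (`Pv` is closed: co-discrete)
  have hPvc : IsClosed Pv := isClosed_of_codiscrete hPvcd
  obtain ⟨wc', Bc, hwc', hwagree, hBc1, hBc2, hBagree, hwcf, hBcf⟩ := exists_scalars_of_coords_global L μK νI 𝓕I ν hν1 (ξ.bcη⁻¹ * ξ.bcψ⁻¹ * μω) φ φ' hqφ
    (fun j => differentiableOn_compl_of_analyticAt_off (hqcvP j)) hqcvq hPvc
    (fun j => integrable_restrict_mul_conj_of_bounded L μK (hφ'c j) hφc (hCb j) hφC)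
    (fun j l => integrable_restrict_mul_conj_of_bounded L μK (hφ'c j) (hφ'c l) (hCb j) (hCb l))
  have hww : wc = wc' := funext fun z => by rw [hwc z, hwcf z]
  -- the joint pole set `P₆ ∪ Pv`: closed, co-discrete
  have hPc : IsClosed (P₆ ∪ Pv) := hP₆c.union hPvc
  have hPcd : ∀ z₀ : ℂ, ∀ᶠ s in 𝓝[≠] z₀, s ∉ P₆ ∪ Pv := fun z₀ => ((hP₆cd z₀).and (hPvcd z₀)).mono fun s hs h => h.elim hs.1 hs.2
  have h6 : (P₆ ∪ Pv)ᶜ ⊆ P₆ᶜ := compl_subset_compl.2 subset_union_left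
  have hv : (P₆ ∪ Pv)ᶜ ⊆ Pvᶜ := compl_subset_compl.2 subset_union_right
  -- pointwise reality at every real `x > 1` off `P₆ ∪ Pv` (★ p864973 §2)
  have hpt : ∀ x : ℝ, 1 < x → ((x : ℝ) : ℂ) ∉ P₆ ∪ Pv → (wc (x : ℂ)).im = 0 := by
    intro x hx hxP
    have hxPv : ((x : ℝ) : ℂ) ∉ Pv := fun h => hxP (Or.inr h)
    have hqa₀ : ∀ j, AnalyticAt ℂ (qcv j) ((x : ℝ) : ℂ) := fun j => hqcvP j _ hxPv
    have hβB : ∃ B : ℝ, ∀ᶠ z in 𝓝[≠] ((x : ℝ) : ℂ), ‖Bc z z‖ ≤ B := exists_eventually_norm_kernelDiag_le_of_coords hqa₀ _ _ hBcf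
    rw [hww]
    exact im_wc_eq_zero_of_exports_free L μ νG μK νI h𝓕I ν h𝓕N hν1 h𝓕c hβ (le_refl (1 : ℝ≥0)) hχ₁u hρ₁ (norm_psi_apply_eq_one L ξ) ξ.hψ hφc hφ hφC Ec hE2 hPc hPcd
      Fam (hFd.mono h6) (fun z hz => hFam z fun h => hz (Or.inl h)) (hwc'.mono hv) hwagree (fun z' => (hBc1 z').mono hv)
      (fun z => (hBc2 z).mono fun u hu h => hu (Or.inr h)) hBagree hx hxP hβB
  exact eventually_im_eq_zero_of_real_offPoles hPcd hpt (by norm_num : (1 : ℝ) < 3 / 2)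

/-! ## §2 HEAD: (R)′τ OF RECORD, fourth edition -/

/-- **(R)′τ OF RECORD, FOURTH EDITION — `resGMidBlockτ ξ μω ≤ L²_res(𝔓)`** with the two AXIS letters of ED. 3 PAID BY NAME: `hreal := hreal_row_of_ports'` (★ p865213's road, §1) and
`hPreal := ★ hPreal_row_of_offAxisBound … hOFFBD` (★ p865213 §3: normal form + off-axis boundedness ⇒ analyticity).  One term over ★ ED. 3.  Per-generator ∕ per-section residue after
this edition: `hUNF`, `hunfK` (W1, F0P2-p11) and `hOFFBD` (K2E3-p29 FILE 2); once: `hDISC`, the F5 block, the frames, `hμu`, `hquad`.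
[cite: MoeglinWaldspurger1995, I.2.18, IV.1.9–IV.1.11, IV.2.3, V.3.13] [cite: Rogawski1990, §13.9 p. 229 (ii)] [cite: Langlands1976, §6–§7] [cite: BernsteinLapid2019, §4, §7] -/
theorem resGMidBlockτ_le_residual_of_record_v4 [MeasurableSpace (AdeleRing (𝓞 L) L)ˣ] [BorelSpace (AdeleRing (𝓞 L) L)ˣ]
    [MeasurableSpace ↥(arch (↥(maximalRealSubfield L)) L (IsCMField.complexConj L) 3 ((StdForm.antidiagonal 3).over L))] [BorelSpace ↥(arch (↥(maximalRealSubfield L)) L (IsCMField.complexConj L) 3 ((StdForm.antidiagonal 3).over L))] [MeasurableSpace ↥(finAdelic (↥(maximalRealSubfield L)) L (IsCMField.complexConj L) 3 ((StdForm.antidiagonal 3).over L))] [BorelSpace ↥(finAdelic (↥(maximalRealSubfield L)) L (IsCMField.complexConj L) 3 ((StdForm.antidiagonal 3).over L))]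
    (μ : Measure (quasiSplit (↥(maximalRealSubfield L)) L (IsCMField.complexConj L) 3).automorphicQuotient) [(quasiSplit (↥(maximalRealSubfield L)) L (IsCMField.complexConj L) 3).IsAutomorphicMeasure μ]
    (𝔓 : (quasiSplit (↥(maximalRealSubfield L)) L (IsCMField.complexConj L) 3).ParabolicUnipotentData) (h𝔓 : ∀ j : 𝔓.ι, 𝔓.radical j = adelicUnipotent (↥(maximalRealSubfield L)) L (IsCMField.complexConj L) 3) (hne : Nonempty 𝔓.ι)
    (μω : HeckeCharacter L) (hμu : μω.IsUnitary) (hquad : (∀ x : Literature.NumberTheory.GaloisRepresentations.ideleGroup ↥(maximalRealSubfield L), μω (AdeleRing.ideleBaseChange (↥(maximalRealSubfield L)) L x) = quadraticHeckeCharCM L x)) (ξ : OneDimAutRepH L)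
    -- L1 at the frame
    -- L1 at the frame
    (hDISC : ∀ (E : Submodule ℂ (resGMidBlock L μ ξ μω).toSubmodule)
          (hE : ∀ k, ∀ x ∈ E, ((resGMidBlock L μ ξ μω).toContRep.restrict (((standardMaximalCompactGL 3 L).comap (adelicVal (↥(maximalRealSubfield L)) L (IsCMField.complexConj L) 3 ((StdForm.antidiagonal 3).over L)) : Subgroup (quasiSplit (↥(maximalRealSubfield L)) L (IsCMField.complexConj L) 3).Adelic)).subtype) k x ∈ E), FiniteDimensional ℂ E →
          (((resGMidBlock L μ ξ μω).toContRep.restrict (((standardMaximalCompactGL 3 L).comap (adelicVal (↥(maximalRealSubfield L)) L (IsCMField.complexConj L) 3 ((StdForm.antidiagonal 3).over L)) : Subgroup (quasiSplit (↥(maximalRealSubfield L)) L (IsCMField.complexConj L) 3).Adelic)).subtype).subRep E hE).IsIrreducible →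
          FiniteDimensional ℂ (Representation.homRangeSum ((resGMidBlock L μ ξ μω).toContRep.restrict (((standardMaximalCompactGL 3 L).comap (adelicVal (↥(maximalRealSubfield L)) L (IsCMField.complexConj L) 3 ((StdForm.antidiagonal 3).over L)) : Subgroup (quasiSplit (↥(maximalRealSubfield L)) L (IsCMField.complexConj L) 3).Adelic)).subtype).toRepresentation (((resGMidBlock L μ ξ μω).toContRep.restrict (((standardMaximalCompactGL 3 L).comap (adelicVal (↥(maximalRealSubfield L)) L (IsCMField.complexConj L) 3 ((StdForm.antidiagonal 3).over L)) : Subgroup (quasiSplit (↥(maximalRealSubfield L)) L (IsCMField.complexConj L) 3).Adelic)).subtype).subRep E hE)))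
    -- the EXPORTS FRAME and the PORTS' HAAR FRAME
    (νG : Measure (quasiSplit (↥(maximalRealSubfield L)) L (IsCMField.complexConj L) 3).Adelic) [νG.IsHaarMeasure] [νG.IsInvInvariant] [SFinite νG]
    (νE : Measure ↥(adelicUnipotent (↥(maximalRealSubfield L)) L (IsCMField.complexConj L) 3)) [νE.IsHaarMeasure] [νE.IsMulRightInvariant] [νE.IsInvInvariant]
    {𝓕E : Set ↥(adelicUnipotent (↥(maximalRealSubfield L)) L (IsCMField.complexConj L) 3)}
    (h𝓕EN : IsFundamentalDomain ↥(rationalUnipotent (↥(maximalRealSubfield L)) L (IsCMField.complexConj L) 3) 𝓕E νE) (h𝓕Ec : IsCompact (closure 𝓕E)) (h𝓕E0 : νE 𝓕E ≠ 0)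
    {β : (quasiSplit (↥(maximalRealSubfield L)) L (IsCMField.complexConj L) 3).Adelic → ℝ≥0∞}
    (hβ : IsCoveringWeight ↥((arithmeticBorel (↥(maximalRealSubfield L)) L (IsCMField.complexConj L) 3).map (quasiSplit (↥(maximalRealSubfield L)) L (IsCMField.complexConj L) 3).arithmeticSubgroup.subtype) β)
    {μZ : Measure (borelQuotient (↥(maximalRealSubfield L)) L (IsCMField.complexConj L) 3)} [SFinite μZ]
    (hμZ : ∀ f : borelQuotient (↥(maximalRealSubfield L)) L (IsCMField.complexConj L) 3 → ℝ≥0∞, Measurable f → ∫⁻ z, f z ∂μZ = ∫⁻ g, β g * f (toBorelQuotient (↥(maximalRealSubfield L)) L (IsCMField.complexConj L) 3 g) ∂νG)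
    (μa : Measure ↥(arch (↥(maximalRealSubfield L)) L (IsCMField.complexConj L) 3 ((StdForm.antidiagonal 3).over L))) [μa.IsHaarMeasure] [μa.IsMulRightInvariant]
    (μf : Measure ↥(finAdelic (↥(maximalRealSubfield L)) L (IsCMField.complexConj L) 3 ((StdForm.antidiagonal 3).over L))) [μf.IsHaarMeasure]
    -- (V) (iii): the F5 scalar rows at `φ := ξ.bcη⁻¹ * μω`, `η := 1`, ONCE
    {S : Set (HeightOneSpectrum (𝓞 L))} {T' : Set (HeightOneSpectrum (𝓞 ↥(maximalRealSubfield L)))}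
    (hS : S.Finite) (hurφ : ∀ w ∉ S, (ξ.bcη⁻¹ * μω).IsUnramifiedAt w) (hT' : T'.Finite) (hurη : ∀ v ∉ T', (1 : HeckeCharacter ↥(maximalRealSubfield L)).IsUnramifiedAt v)
    (q qc : ℂ → ℂ) {P : Set ℂ} (hqcq : ∀ z : ℂ, 2 < z.re → qc z = q z) (hPcd : ∀ z₀ : ℂ, ∀ᶠ s in 𝓝[≠] z₀, s ∉ P) (hqa : ∀ z : ℂ, z ∉ P → AnalyticAt ℂ qc z)
    (A : ℂ → ℂ) (hA : DifferentiableOn ℂ A {z : ℂ | 1 < z.re})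
    (hsrc : ∀ z : ℂ, 2 < z.re → q z = A z *
          ((partialStandardL S (fun w => {(ξ.bcη⁻¹ * μω).valueAtUniformizer w}) (z - 1) * partialStandardL T' (fun v => {(1 : HeckeCharacter ↥(maximalRealSubfield L)).valueAtUniformizer v}) (2 * z - 2)) /
            (partialStandardL S (fun w => {(ξ.bcη⁻¹ * μω).valueAtUniformizer w}) z * partialStandardL T' (fun v => {(1 : HeckeCharacter ↥(maximalRealSubfield L)).valueAtUniformizer v}) (2 * z - 1))))
    (hA32 : A (3 / 2) ≠ 0)
    -- PER τ-GENERATOR: the UNFOLDING letter (W1)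
    (hUNF :
      ∀ (U₀ : Subgroup ↥(finAdelic (↥(maximalRealSubfield L)) L (IsCMField.complexConj L) 3 ((StdForm.antidiagonal 3).over L))) (_ : IsTauLevel L U₀)
      (φ : (quasiSplit (↥(maximalRealSubfield L)) L (IsCMField.complexConj L) 3).Adelic → ℂ) (_ : φ ∈ chiSectionSpacePair (ξ.bcη⁻¹ * ξ.bcψ⁻¹ * μω) ξ.ψ (tauLevel L U₀) ((1 : ↥(tauLevel L U₀) →* ℂ) : ↥(tauLevel L U₀) → ℂ)) (_ : Continuous φ)
      (_ : IsArchFinite L φ)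
      (Ec : ℂ → (quasiSplit (↥(maximalRealSubfield L)) L (IsCMField.complexConj L) 3).Adelic → ℂ) (Sp : Finset ℂ) (_ : ∀ s ∈ Sp, s.im = 0 ∧ 1 < s.re ∧ s.re ≤ 2)
      (_ : ∀ g, DifferentiableOn ℂ (fun z => Ec z g) ({z : ℂ | 1 < z.re} \ (↑Sp : Set ℂ)))
      (_ : ∀ z : ℂ, 2 < z.re → Ec z = eisensteinSeriesU (flatSectionU φ z))
      (Fp : (quasiSplit (↥(maximalRealSubfield L)) L (IsCMField.complexConj L) 3).Adelic → ℂ → ℂ) (_ : ∀ g, AnalyticAt ℂ (Fp g) ((3 : ℂ) / 2))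
      (_ : ∀ g, Fp g =ᶠ[𝓝[≠] ((3 : ℂ) / 2)] fun z => (z - (3 : ℂ) / 2) * Ec z g)
      (f : (quasiSplit (↥(maximalRealSubfield L)) L (IsCMField.complexConj L) 3).L2 μ) (_ : (f : (quasiSplit (↥(maximalRealSubfield L)) L (IsCMField.complexConj L) 3).automorphicQuotient → ℂ) =ᵐ[μ] fun x => Fp (Quotient.out (x : (quasiSplit (↥(maximalRealSubfield L)) L (IsCMField.complexConj L) 3).Adelic ⧸ (quasiSplit (↥(maximalRealSubfield L)) L (IsCMField.complexConj L) 3).quotientSubgroup))⁻¹ ((3 : ℂ) / 2))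
      (ν : Measure ↥(adelicUnipotent (↥(maximalRealSubfield L)) L (IsCMField.complexConj L) 3)) (_ : ν.IsHaarMeasure) (𝓕 : Set ↥(adelicUnipotent (↥(maximalRealSubfield L)) L (IsCMField.complexConj L) 3)) (_ : IsFundamentalDomain ↥(rationalUnipotent (↥(maximalRealSubfield L)) L (IsCMField.complexConj L) 3) 𝓕 ν) (_ : IsCompact (closure 𝓕)) (_ : ν.IsInvInvariant) (_ : ν 𝓕 = 1),
      ∃ (Ag : (quasiSplit (↥(maximalRealSubfield L)) L (IsCMField.complexConj L) 3).Adelic → ℂ → ℂ) (M : ℝ),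
        (∀ g, DifferentiableOn ℂ (Ag g) {z : ℂ | 1 < z.re}) ∧ (∀ g, ‖Ag g (3 / 2)‖ ≤ M) ∧
        (∀ z : ℂ, 2 < z.re → ∀ g : (quasiSplit (↥(maximalRealSubfield L)) L (IsCMField.complexConj L) 3).Adelic, (borelConstantTerm ν 𝓕 (Ec z) g - φ g * (((borelHeight g : ℝ≥0) : ℝ) : ℂ) ^ z) / (((borelHeight g : ℝ≥0) : ℝ) : ℂ) ^ (2 - z) = Ag g z *
          ((partialStandardL S (fun w => {(ξ.bcη⁻¹ * μω).valueAtUniformizer w}) (z - 1) * partialStandardL T' (fun v => {(1 : HeckeCharacter ↥(maximalRealSubfield L)).valueAtUniformizer v}) (2 * z - 2)) /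
            (partialStandardL S (fun w => {(ξ.bcη⁻¹ * μω).valueAtUniformizer w}) z * partialStandardL T' (fun v => {(1 : HeckeCharacter ↥(maximalRealSubfield L)).valueAtUniformizer v}) (2 * z - 1)))))
    -- PER τ-ADMISSIBLE SECTION: the per-base-point Euler factorisation on `K_max` AT THE SCALAR OF RECORD (W1)
    (hunfK :
      ∀ (U₀ : Subgroup ↥(finAdelic (↥(maximalRealSubfield L)) L (IsCMField.complexConj L) 3 ((StdForm.antidiagonal 3).over L))) (_ : IsTauLevel L U₀)
      (φ : (quasiSplit (↥(maximalRealSubfield L)) L (IsCMField.complexConj L) 3).Adelic → ℂ) (_ : φ ∈ chiSectionSpacePair (ξ.bcη⁻¹ * ξ.bcψ⁻¹ * μω) ξ.ψ (tauLevel L U₀) ((1 : ↥(tauLevel L U₀) →* ℂ) : ↥(tauLevel L U₀) → ℂ)) (_ : Continuous φ)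
      (_ : IsArchFinite L φ)
      (ν : Measure ↥(adelicUnipotent (↥(maximalRealSubfield L)) L (IsCMField.complexConj L) 3)) (_ : ν.IsHaarMeasure) (𝓕 : Set ↥(adelicUnipotent (↥(maximalRealSubfield L)) L (IsCMField.complexConj L) 3)) (_ : IsFundamentalDomain ↥(rationalUnipotent (↥(maximalRealSubfield L)) L (IsCMField.complexConj L) 3) 𝓕 ν) (_ : IsCompact (closure 𝓕)) (_ : ν.IsInvInvariant) (_ : ν 𝓕 = 1),
      ∀ k : (quasiSplit (↥(maximalRealSubfield L)) L (IsCMField.complexConj L) 3).Adelic, adelicVal (↥(maximalRealSubfield L)) L (IsCMField.complexConj L) 3 ((StdForm.antidiagonal 3).over L) k ∈ standardMaximalCompactGL 3 L →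
        ∃ A' : ℂ → ℂ, DifferentiableOn ℂ A' {z : ℂ | 1 < z.re} ∧ ∀ z : ℂ, 2 < z.re →
          (∫ v : ↥(adelicUnipotent (↥(maximalRealSubfield L)) L (IsCMField.complexConj L) 3), flatSectionU φ z ((quasiSplit (↥(maximalRealSubfield L)) L (IsCMField.complexConj L) 3).toAdelic (weylLongU ((IsCMField.complexConj L : L ≃ₐ[↥(maximalRealSubfield L)] L) : L →+* L) (rfl : (StdForm.antidiagonal 3).over L = (StdForm.antidiagonal 3).over L)) * ((v : (quasiSplit (↥(maximalRealSubfield L)) L (IsCMField.complexConj L) 3).Adelic) * k)) ∂ν) =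
            ((partialStandardL S (fun w => {(ξ.bcη⁻¹ * μω).valueAtUniformizer w}) (z - 1) * partialStandardL T' (fun v => {(1 : HeckeCharacter ↥(maximalRealSubfield L)).valueAtUniformizer v}) (2 * z - 2)) / (partialStandardL S (fun w => {(ξ.bcη⁻¹ * μω).valueAtUniformizer w}) z * partialStandardL T' (fun v => {(1 : HeckeCharacter ↥(maximalRealSubfield L)).valueAtUniformizer v}) (2 * z - 1))) * A' z)
    -- PER τ-ADMISSIBLE SECTION: OFF-AXIS BOUNDEDNESS of the continued coordinates in `{1 < Re}` (★ p865213 §3's binder, K2E3-p29 FILE 2 pays it) [MW95 IV.1.11]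
    (hOFFBD : ∀ (U₀ : Subgroup ↥(finAdelic (↥(maximalRealSubfield L)) L (IsCMField.complexConj L) 3 ((StdForm.antidiagonal 3).over L))) (_ : IsTauLevel L U₀)
      (φ : (quasiSplit (↥(maximalRealSubfield L)) L (IsCMField.complexConj L) 3).Adelic → ℂ) (_ : φ ∈ chiSectionSpacePair (ξ.bcη⁻¹ * ξ.bcψ⁻¹ * μω) ξ.ψ (tauLevel L U₀) ((1 : ↥(tauLevel L U₀) →* ℂ) : ↥(tauLevel L U₀) → ℂ)) (_ : Continuous φ)
      (_ : IsArchFinite L φ)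
      (ν : Measure ↥(adelicUnipotent (↥(maximalRealSubfield L)) L (IsCMField.complexConj L) 3)) (_ : ν.IsHaarMeasure) (𝓕 : Set ↥(adelicUnipotent (↥(maximalRealSubfield L)) L (IsCMField.complexConj L) 3))
      (_ : IsFundamentalDomain ↥(rationalUnipotent (↥(maximalRealSubfield L)) L (IsCMField.complexConj L) 3) 𝓕 ν) (_ : IsCompact (closure 𝓕)) (_ : ν.IsInvInvariant) (_ : ν 𝓕 = 1),
      ∀ (ι : Type) [Fintype ι] (φ' : ι → (quasiSplit (↥(maximalRealSubfield L)) L (IsCMField.complexConj L) 3).Adelic → ℂ) (qv qcv : ι → ℂ → ℂ) (Pv : Set ℂ),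
        LinearIndependent ℂ φ' →
        (∀ j, IsChiSectionPair (reflectChar (IsCMField.complexConj L) (ξ.bcη⁻¹ * ξ.bcψ⁻¹ * μω)) ξ.ψ (φ' j)) →
        (∀ j, Continuous (φ' j)) →
        (∀ j, ∃ C : ℝ, ∀ x, ‖φ' j x‖ ≤ C) →
        (∀ z : ℂ, 2 < z.re → (∑ j, qv j z • φ' j) = ((((ν 𝓕).toReal⁻¹ : ℝ)) : ℂ) • (fun g : (quasiSplit (↥(maximalRealSubfield L)) L (IsCMField.complexConj L) 3).Adelic => (∫ v : ↥(adelicUnipotent (↥(maximalRealSubfield L)) L (IsCMField.complexConj L) 3), flatSectionU φ z ((quasiSplit (↥(maximalRealSubfield L)) L (IsCMField.complexConj L) 3).toAdelic (weylLongU ((IsCMField.complexConj L : L ≃ₐ[↥(maximalRealSubfield L)] L) : L →+* L) (rfl : (StdForm.antidiagonal 3).over L = (StdForm.antidiagonal 3).over L)) * ((v : (quasiSplit (↥(maximalRealSubfield L)) L (IsCMField.complexConj L) 3).Adelic) * g)) ∂ν) * (((borelHeight g : ℝ) : ℂ) ^ (z - 2)))) →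
        (∀ z₀ : ℂ, ∀ᶠ s in 𝓝[≠] z₀, s ∉ Pv) →
        (∀ z ∈ Pv, z.re ≤ 2) →
        (∀ j (z : ℂ), z ∉ Pv → AnalyticAt ℂ (qcv j) z) →
        (∀ j (z : ℂ), 2 < z.re → qcv j z = qv j z) →
        (∀ j, MeromorphicNFOn (qcv j) univ) →
      ∀ z₀ : ℂ, 1 < z₀.re → z₀.im ≠ 0 → ∃ C : ℝ, ∀ᶠ z in 𝓝[≠] z₀, ∀ j, ‖qcv j z‖ ≤ C) :
    resGMidBlockτ L μ ξ μω ≤ residualSubspace (quasiSplit (↥(maximalRealSubfield L)) L (IsCMField.complexConj L) 3) μ 𝔓 :=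
  resGMidBlockτ_le_residual_of_record_v3 L μ 𝔓 h𝔓 hne μω hμu hquad ξ hDISC νG νE h𝓕EN h𝓕Ec h𝓕E0 hβ hμZ μa μf hS hurφ hT' hurη q qc hqcq hPcd hqa A hA hsrc hA32 hUNF hunfK
    (hPreal_row_of_offAxisBound L ξ μω hOFFBD) (hreal_row_of_ports' L μ νG hβ hμZ μa μf ξ μω hμu hquad)

/-! ## §3 (R)′ under the τ-density letters -/

omit [MeasurableSpace (quasiSplit (↥(maximalRealSubfield L)) L (IsCMField.complexConj L) 3).Adelic] [BorelSpace (quasiSplit (↥(maximalRealSubfield L)) L (IsCMField.complexConj L) 3).Adelic] in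
/-- **(R)′ FROM (R)′τ UNDER THE τ-DENSITY LETTERS** (J-S8-hW1 road ★ p865244 `hW1_of_tauDensity`): `hFIN` and `hDENSτ` (every τ-level atom is the τ-atom) give `hW1`, hence (R)′'s
body from the τ-head by one `le_trans` — offered next to ★ ED. 3's `resGMidBlock_le_residual_of_isotypic_of_tau`. [cite: MoeglinWaldspurger1995, I.2.17–I.2.18, II.1, V.3.13] -/
theorem resGMidBlock_le_residual_of_tauDensity_of_tau
    (μ : Measure (quasiSplit (↥(maximalRealSubfield L)) L (IsCMField.complexConj L) 3).automorphicQuotient) [(quasiSplit (↥(maximalRealSubfield L)) L (IsCMField.complexConj L) 3).IsAutomorphicMeasure μ]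
    (𝔓 : (quasiSplit (↥(maximalRealSubfield L)) L (IsCMField.complexConj L) 3).ParabolicUnipotentData) (ξ : OneDimAutRepH L) (μω : HeckeCharacter L)
    (hFIN : resGMidAtom L μ ξ μω ⊥ 1 ≤
      (⨆ (U₀ : Subgroup ↥(finAdelic (↥(maximalRealSubfield L)) L (IsCMField.complexConj L) 3 ((StdForm.antidiagonal 3).over L))) (_ : IsTauLevel L U₀),
        resGMidAtom L μ ξ μω (tauLevel L U₀) 1).topologicalClosure)
    (hDENSτ : ∀ (U₀ : Subgroup ↥(finAdelic (↥(maximalRealSubfield L)) L (IsCMField.complexConj L) 3 ((StdForm.antidiagonal 3).over L))), IsTauLevel L U₀ →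
      resGMidAtom L μ ξ μω (tauLevel L U₀) 1 ≤ resGMidAtomτ L μ ξ μω U₀)
    (hτ : resGMidBlockτ L μ ξ μω ≤ residualSubspace (quasiSplit (↥(maximalRealSubfield L)) L (IsCMField.complexConj L) 3) μ 𝔓) :
    resGMidBlock L μ ξ μω ≤ residualSubspace (quasiSplit (↥(maximalRealSubfield L)) L (IsCMField.complexConj L) 3) μ 𝔓 :=
  (hW1_of_tauDensity L μ ξ μω hFIN hDENSτ).trans hτ

end Summit.HodgeConjecture.HodgeConjecture.R90.S8

end
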